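import Summits.CriticalPhenomena.PercolationContinuityZ3.Theorems.PercNearOneGluingNoHeavyLowerTailTransportMass
import Mathlib.Tactic.Linarith
import Mathlib.Tactic.Ring
import Mathlib.Tactic.FieldSimp
import HarnessLib
import HarnessLib.Audit

/-!
# `NoHeavyLowerTail` (crux stmt-CriticalPhenomena-4575), Sahi programme P4 (monotone coupling): a CONSTRUCTIVE monotone
# coupling (Holley / Strassen transport) of a product measure conditioned on a decreasing event below the same measure
# conditioned on an increasing event — and Harris' inequality as its corollary

Support file (cell `prim-l12`, seat P4; `--supports stmt-CriticalPhenomena-4575`).  No named facts, no sorries, no conjectures.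
SETTING: the weighted cube on a finite coordinate set `D` (`DecisionTree.wtW D p S`, `p i ∈ [0,1]`), a DOWN-closed predicate `Dn`
and an UP-closed predicate `Up` on configurations (`Finset ι` under `⊆`), masses `d = μ(Dn)`, `s = μ(Up)` (`pmass`).
THEOREM `exists_monotone_transport`: there is an UPWARD flow `f ≥ 0` (`f y x ≠ 0 → y ⊆ x ⊆ D`, `Dn y`, `Up x`) with row sums
`s·μ(y)·1[Dn y]` and column sums `d·μ(x)·1[Up x]` — after normalising, a MONOTONE COUPLING of `μ(·|Dn)` below `μ(·|Up)`
(Strassen's coupling for this pair), built by an explicit recursion on the coordinates: peeling `e`, the `e ∈ ·` layer is coupled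
by the transport of the sections `(Dn¹, Up¹)`, the `e ∉ ·` layer by that of `(Dn, Up)`, and the surplus of the lower layer goes up
by the transport of `(Dn, Up¹)`; the three scalars are forced by the marginals and are nonnegative because `μ(Dn¹) ≤ μ(Dn)` and
`μ(Up) ≤ μ(Up¹)`.  No correlation inequality is used; on the contrary, COROLLARY `pmass_mul_pmass_le` (Harris–Kleitman by
coupling, "nothing flows out of an up-set"): `μ(Up)·μ(Dn ∧ W) ≤ μ(Dn)·μ(Up ∧ W)` for up-closed `W`; `Dn = ⊤` gives Harris
`μ(Up)·μ(W) ≤ μ(Up ∧ W)` (`harris_of_transport`), `Dn = ¬Up` gives `μ(W | ¬Up) ≤ μ(W | Up)`.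
SPECIAL CASES: `Dn = ⊤` is the Holley coupling of `μ` below `μ(·|Up)`; `Dn = ¬Up` is the exact "`Up`-fixing" transport of
`μ|_{¬Up}` onto `((1−s)/s)·μ|_{Up}` of the transport form of Sahi's `C₃` (`…C3Transport`; for an independent pair of up-sets the
`C₃`-flow is forced to be this transport of the other block).  [this work; existence is a folklore consequence of Strassen 1965 +
Harris 1960, the recursion and the Lean proof are ours]
-/

noncomputable section

open scoped Classical

namespace Summit.CriticalPhenomena.PercolationContinuityZ3.Theorems.C3Transport

open Finset Literature.Probability.Percolation.DecisionTree

variable {ι : Type*} [DecidableEq ι]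

/-! ### The transport -/

/-- **A monotone transport between `μ(·|Dn)` and `μ(·|Up)`** on the weighted cube `D`: an upward flow supported on
`Dn × Up` inside `D`, with row sums `μ(Up)·μ(y)·1[Dn y]` and column sums `μ(Dn)·μ(x)·1[Up x]`. [this work] -/
structure IsMonotoneTransport (D : Finset ι) (p : ι → ℝ) (Dn Up : Finset ι → Prop) (f : Finset ι → Finset ι → ℝ) :
    Prop where
  /-- nonnegative -/
  nonneg : ∀ y x, 0 ≤ f y x
  /-- upward, inside `D`, from `Dn` to `Up` -/
  supp : ∀ y x, f y x ≠ 0 → y ⊆ x ∧ x ⊆ D ∧ Dn y ∧ Up x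
  /-- row sums -/
  row : ∀ y ∈ D.powerset, ∑ x ∈ D.powerset, f y x = pmass D p Up * (if Dn y then wtW D p y else 0)
  /-- column sums -/
  col : ∀ x ∈ D.powerset, ∑ y ∈ D.powerset, f y x = pmass D p Dn * (if Up x then wtW D p x else 0)

/-- **Existence of the monotone transport (constructive Strassen/Holley coupling for conditioned product measures).**
For `p ∈ [0,1]`, a down-closed `Dn` and an up-closed `Up` there is an `IsMonotoneTransport D p Dn Up f`.  Proof: recursion on
the coordinates (see the module docstring); only the monotonicity of sections is used. [this work] -/
theorem exists_monotone_transport (D : Finset ι) {p : ι → ℝ} (hp0 : ∀ i, 0 ≤ p i) (hp1 : ∀ i, p i ≤ 1)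
    (Dn Up : Finset ι → Prop) (hDn : ∀ ⦃x y : Finset ι⦄, y ⊆ x → Dn x → Dn y)
    (hUp : ∀ ⦃x y : Finset ι⦄, y ⊆ x → Up y → Up x) :
    ∃ f : Finset ι → Finset ι → ℝ, IsMonotoneTransport D p Dn Up f := by
  induction D using Finset.induction_on generalizing Dn Up with
  | empty =>
    refine ⟨fun y x => if y = ∅ ∧ x = ∅ then (if Up ∅ then (1 : ℝ) else 0) * (if Dn ∅ then 1 else 0) else 0,
      ⟨?_, ?_, ?_, ?_⟩⟩
    · intro y x
      split_ifs <;> norm_num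
    · intro y x h
      by_cases hyx : y = ∅ ∧ x = ∅
      · rcases hyx with ⟨rfl, rfl⟩
        simp only [and_self, if_true] at h
        refine ⟨le_rfl, le_rfl, ?_, ?_⟩
        · by_contra hD; simp [hD] at h
        · by_contra hU; simp [hU] at h
      · simp [hyx] at h
    · intro y hy
      rw [Finset.powerset_empty, Finset.mem_singleton] at hy
      subst hy
      rw [Finset.powerset_empty, Finset.sum_singleton, pmass_eq_sum, Finset.powerset_empty, Finset.sum_singleton]
      simp [wtW]
    · intro x hx
      rw [Finset.powerset_empty, Finset.mem_singleton] at hx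
      subst hx
      rw [Finset.powerset_empty, Finset.sum_singleton, pmass_eq_sum, Finset.powerset_empty, Finset.sum_singleton]
      simp [wtW]
      split_ifs <;> simp
  | @insert e D' he ih =>
    -- sections
    set Dn1 : Finset ι → Prop := fun S => Dn (insert e S) with hDn1
    set Up1 : Finset ι → Prop := fun S => Up (insert e S) with hUp1
    have hDn1_lower : ∀ ⦃x y : Finset ι⦄, y ⊆ x → Dn1 x → Dn1 y := fun x y hyx hx =>
      hDn (Finset.insert_subset_insert e hyx) hx
    have hUp1_upper : ∀ ⦃x y : Finset ι⦄, y ⊆ x → Up1 y → Up1 x := fun x y hyx hy =>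
      hUp (Finset.insert_subset_insert e hyx) hy
    obtain ⟨g11, hg11⟩ := ih Dn1 Up1 hDn1_lower hUp1_upper
    obtain ⟨g00, hg00⟩ := ih Dn Up hDn hUp
    obtain ⟨g01, hg01⟩ := ih Dn Up1 hDn hUp1_upper
    -- masses
    set d0 := pmass D' p Dn with hd0
    set d1 := pmass D' p Dn1 with hd1
    set s0 := pmass D' p Up with hs0
    set s1 := pmass D' p Up1 with hs1
    set d := pmass (insert e D') p Dn with hd
    set s := pmass (insert e D') p Up with hs
    have hd_eq : d = (1 - p e) * d0 + p e * d1 := pmass_insert p he Dn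
    have hs_eq : s = (1 - p e) * s0 + p e * s1 := pmass_insert p he Up
    have hd0n : 0 ≤ d0 := pmass_nonneg D' hp0 hp1 Dn
    have hd1n : 0 ≤ d1 := pmass_nonneg D' hp0 hp1 Dn1
    have hs0n : 0 ≤ s0 := pmass_nonneg D' hp0 hp1 Up
    have hs1n : 0 ≤ s1 := pmass_nonneg D' hp0 hp1 Up1
    have hd10 : d1 ≤ d0 := pmass_mono D' hp0 hp1 fun S _ hS => hDn (Finset.subset_insert e S) hS
    have hs01 : s0 ≤ s1 := pmass_mono D' hp0 hp1 fun S _ hS => hUp (Finset.subset_insert e S) hS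
    have hpe0 : 0 ≤ p e := hp0 e
    have hpe1 : 0 ≤ 1 - p e := sub_nonneg.2 (hp1 e)
    have hkey : 0 ≤ d0 * s1 - s0 * d1 := by nlinarith
    -- scalars
    set α := s * p e / s1 with hα
    set β := d * (1 - p e) / d0 with hβ
    set γ := p e * (1 - p e) * (d0 * s1 - s0 * d1) / (s1 * d0) with hγ
    have hαn : 0 ≤ α := div_nonneg (mul_nonneg (pmass_nonneg _ hp0 hp1 Up) hpe0) hs1n
    have hβn : 0 ≤ β := div_nonneg (mul_nonneg (pmass_nonneg _ hp0 hp1 Dn) hpe1) hd0n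
    have hγn : 0 ≤ γ := div_nonneg (mul_nonneg (mul_nonneg hpe0 hpe1) hkey) (mul_nonneg hs1n hd0n)
    -- the flow
    refine ⟨fun y x => if e ∈ y then (if e ∈ x then α * g11 (y.erase e) (x.erase e) else 0)
        else (if e ∈ x then γ * g01 y (x.erase e) else β * g00 y x), ⟨?_, ?_, ?_, ?_⟩⟩
    · -- nonneg
      intro y x
      show 0 ≤ (if e ∈ y then _ else _)
      split_ifs
      · exact mul_nonneg hαn (hg11.nonneg _ _)
      · exact le_rfl
      · exact mul_nonneg hγn (hg01.nonneg _ _)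
      · exact mul_nonneg hβn (hg00.nonneg _ _)
    · -- support
      intro y x h
      change (if e ∈ y then _ else _) ≠ 0 at h
      by_cases hey : e ∈ y
      · rw [if_pos hey] at h
        by_cases hex : e ∈ x
        · rw [if_pos hex] at h
          have hg : g11 (y.erase e) (x.erase e) ≠ 0 := fun h0 => h (by rw [h0, mul_zero])
          obtain ⟨h1, h2, h3, h4⟩ := hg11.supp _ _ hg
          refine ⟨?_, ?_, ?_, ?_⟩
          · intro i hi
            by_cases hie : i = e
            · exact hie ▸ hex
            · exact Finset.mem_of_mem_erase (h1 (Finset.mem_erase.2 ⟨hie, hi⟩))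
          · intro i hi
            by_cases hie : i = e
            · exact hie ▸ Finset.mem_insert_self e D'
            · exact Finset.mem_insert_of_mem (h2 (Finset.mem_erase.2 ⟨hie, hi⟩))
          · have := h3; simp only [hDn1] at this; rwa [Finset.insert_erase hey] at this
          · have := h4; simp only [hUp1] at this; rwa [Finset.insert_erase hex] at this
        · rw [if_neg hex] at h; exact absurd rfl h
      · rw [if_neg hey] at h
        by_cases hex : e ∈ x
        · rw [if_pos hex] at h
          have hg : g01 y (x.erase e) ≠ 0 := fun h0 => h (by rw [h0, mul_zero])
          obtain ⟨h1, h2, h3, h4⟩ := hg01.supp _ _ hg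
          refine ⟨fun i hi => Finset.mem_of_mem_erase (h1 hi), ?_, h3, ?_⟩
          · intro i hi
            by_cases hie : i = e
            · exact hie ▸ Finset.mem_insert_self e D'
            · exact Finset.mem_insert_of_mem (h2 (Finset.mem_erase.2 ⟨hie, hi⟩))
          · have := h4; simp only [hUp1] at this; rwa [Finset.insert_erase hex] at this
        · rw [if_neg hex] at h
          have hg : g00 y x ≠ 0 := fun h0 => h (by rw [h0, mul_zero])
          obtain ⟨h1, h2, h3, h4⟩ := hg00.supp _ _ hg
          exact ⟨h1, h2.trans (Finset.subset_insert e D'), h3, h4⟩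
    · -- row sums
      intro y hy
      have hyD : y ⊆ insert e D' := Finset.mem_powerset.1 hy
      rw [← hs, Finset.sum_powerset_insert he]
      by_cases hey : e ∈ y
      · -- upper layer: only `α · g11`
        set y' := y.erase e with hy'
        have hy'D : y' ⊆ D' := by
          intro i hi
          have hi' := Finset.mem_erase.1 hi
          rcases Finset.mem_insert.1 (hyD hi'.2) with h | h
          · exact absurd h hi'.1
          · exact h
        have hyeq : y = insert e y' := (Finset.insert_erase hey).symm
        have h1 : ∑ x ∈ D'.powerset, (if e ∈ y then (if e ∈ x then α * g11 (y.erase e) (x.erase e) else 0)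
            else (if e ∈ x then γ * g01 y (x.erase e) else β * g00 y x)) = 0 := by
          refine Finset.sum_eq_zero fun x hx => ?_
          have hex : e ∉ x := fun h => he (Finset.mem_powerset.1 hx h)
          rw [if_pos hey, if_neg hex]
        have h2 : ∑ x ∈ D'.powerset, (if e ∈ y then (if e ∈ insert e x then α * g11 (y.erase e) ((insert e x).erase e) else 0)
            else (if e ∈ insert e x then γ * g01 y ((insert e x).erase e) else β * g00 y (insert e x)))
            = α * (s1 * (if Dn1 y' then wtW D' p y' else 0)) := by
          rw [← hg11.row y' (Finset.mem_powerset.2 hy'D), Finset.mul_sum]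
          refine Finset.sum_congr rfl fun x hx => ?_
          have hex : e ∉ x := fun h => he (Finset.mem_powerset.1 hx h)
          rw [if_pos hey, if_pos (Finset.mem_insert_self e x), Finset.erase_insert hex]
        rw [h1, h2, zero_add]
        have hDy : Dn1 y' ↔ Dn y := by simp only [hDn1]; rw [← hyeq]
        rw [hyeq, wtW_insert_insert p he y', ← hyeq]
        by_cases hDny : Dn y
        · rw [if_pos (hDy.2 hDny), if_pos hDny]
          by_cases hs1z : s1 = 0
          · -- then `s = 0`
            have hs0z : s0 = 0 := le_antisymm (hs1z ▸ hs01) hs0n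
            have hsz : s = 0 := by rw [hs_eq, hs0z, hs1z]; ring
            rw [hα, hsz, hs1z]; simp
          · rw [hα]; field_simp
        · rw [if_neg (fun h => hDny (hDy.1 h)), if_neg hDny]; ring
      · -- lower layer: `β · g00` stays, `γ · g01` goes up
        have hyD' : y ⊆ D' := by
          intro i hi
          rcases Finset.mem_insert.1 (hyD hi) with h | h
          · exact absurd (h ▸ hi) hey
          · exact h
        have h1 : ∑ x ∈ D'.powerset, (if e ∈ y then (if e ∈ x then α * g11 (y.erase e) (x.erase e) else 0)
            else (if e ∈ x then γ * g01 y (x.erase e) else β * g00 y x))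
            = β * (s0 * (if Dn y then wtW D' p y else 0)) := by
          rw [← hg00.row y (Finset.mem_powerset.2 hyD'), Finset.mul_sum]
          refine Finset.sum_congr rfl fun x hx => ?_
          have hex : e ∉ x := fun h => he (Finset.mem_powerset.1 hx h)
          rw [if_neg hey, if_neg hex]
        have h2 : ∑ x ∈ D'.powerset, (if e ∈ y then (if e ∈ insert e x then α * g11 (y.erase e) ((insert e x).erase e) else 0)
            else (if e ∈ insert e x then γ * g01 y ((insert e x).erase e) else β * g00 y (insert e x)))
            = γ * (s1 * (if Dn y then wtW D' p y else 0)) := by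
          rw [← hg01.row y (Finset.mem_powerset.2 hyD'), Finset.mul_sum]
          refine Finset.sum_congr rfl fun x hx => ?_
          have hex : e ∉ x := fun h => he (Finset.mem_powerset.1 hx h)
          rw [if_neg hey, if_pos (Finset.mem_insert_self e x), Finset.erase_insert hex]
        rw [h1, h2, wtW_insert_of_notMem p he hey]
        by_cases hDny : Dn y
        · simp only [if_pos hDny]
          by_cases hd0z : d0 = 0
          · have hw : wtW D' p y = 0 := wtW_eq_zero_of_pmass_eq_zero D' hp0 hp1 hd0z hyD' hDny
            rw [hw]; ring
          · by_cases hs1z : s1 = 0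
            · have hs0z : s0 = 0 := le_antisymm (hs1z ▸ hs01) hs0n
              have hsz : s = 0 := by rw [hs_eq, hs0z, hs1z]; ring
              rw [hβ, hγ, hsz, hs1z, hs0z]; simp
            · rw [hβ, hγ, hs_eq, hd_eq]
              field_simp
              ring
        · simp only [if_neg hDny]; ring
    · -- column sums
      intro x hx
      have hxD : x ⊆ insert e D' := Finset.mem_powerset.1 hx
      rw [← hd, Finset.sum_powerset_insert he]
      by_cases hex : e ∈ x
      · set x' := x.erase e with hx'
        have hx'D : x' ⊆ D' := by
          intro i hi
          have hi' := Finset.mem_erase.1 hi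
          rcases Finset.mem_insert.1 (hxD hi'.2) with h | h
          · exact absurd h hi'.1
          · exact h
        have hxeq : x = insert e x' := (Finset.insert_erase hex).symm
        have h1 : ∑ y ∈ D'.powerset, (if e ∈ y then (if e ∈ x then α * g11 (y.erase e) (x.erase e) else 0)
            else (if e ∈ x then γ * g01 y (x.erase e) else β * g00 y x))
            = γ * (d0 * (if Up1 x' then wtW D' p x' else 0)) := by
          rw [← hg01.col x' (Finset.mem_powerset.2 hx'D), Finset.mul_sum]
          refine Finset.sum_congr rfl fun y hy => ?_
          have hey : e ∉ y := fun h => he (Finset.mem_powerset.1 hy h)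
          rw [if_neg hey, if_pos hex]
        have h2 : ∑ y ∈ D'.powerset, (if e ∈ insert e y then (if e ∈ x then α * g11 ((insert e y).erase e) (x.erase e) else 0)
            else (if e ∈ x then γ * g01 (insert e y) (x.erase e) else β * g00 (insert e y) x))
            = α * (d1 * (if Up1 x' then wtW D' p x' else 0)) := by
          rw [← hg11.col x' (Finset.mem_powerset.2 hx'D), Finset.mul_sum]
          refine Finset.sum_congr rfl fun y hy => ?_
          have hey : e ∉ y := fun h => he (Finset.mem_powerset.1 hy h)
          rw [if_pos (Finset.mem_insert_self e y), if_pos hex, Finset.erase_insert hey]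
        rw [h1, h2]
        have hUx : Up1 x' ↔ Up x := by simp only [hUp1]; rw [← hxeq]
        rw [hxeq, wtW_insert_insert p he x', ← hxeq]
        by_cases hUpx : Up x
        · rw [if_pos (hUx.2 hUpx), if_pos hUpx]
          by_cases hs1z : s1 = 0
          · have hw : wtW D' p x' = 0 := wtW_eq_zero_of_pmass_eq_zero D' hp0 hp1 hs1z hx'D (hUx.2 hUpx)
            rw [hw]; ring
          · by_cases hd0z : d0 = 0
            · have hd1z : d1 = 0 := le_antisymm (hd0z ▸ hd10) hd1n
              have hdz : d = 0 := by rw [hd_eq, hd0z, hd1z]; ring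
              rw [hα, hγ, hdz, hd0z, hd1z]; simp
            · rw [hα, hγ, hs_eq, hd_eq]
              field_simp
              ring
        · rw [if_neg (fun h => hUpx (hUx.1 h)), if_neg hUpx]; ring
      · have hxD' : x ⊆ D' := by
          intro i hi
          rcases Finset.mem_insert.1 (hxD hi) with h | h
          · exact absurd (h ▸ hi) hex
          · exact h
        have h1 : ∑ y ∈ D'.powerset, (if e ∈ y then (if e ∈ x then α * g11 (y.erase e) (x.erase e) else 0)
            else (if e ∈ x then γ * g01 y (x.erase e) else β * g00 y x))
            = β * (d0 * (if Up x then wtW D' p x else 0)) := by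
          rw [← hg00.col x (Finset.mem_powerset.2 hxD'), Finset.mul_sum]
          refine Finset.sum_congr rfl fun y hy => ?_
          have hey : e ∉ y := fun h => he (Finset.mem_powerset.1 hy h)
          rw [if_neg hey, if_neg hex]
        have h2 : ∑ y ∈ D'.powerset, (if e ∈ insert e y then (if e ∈ x then α * g11 ((insert e y).erase e) (x.erase e) else 0)
            else (if e ∈ x then γ * g01 (insert e y) (x.erase e) else β * g00 (insert e y) x)) = 0 := by
          refine Finset.sum_eq_zero fun y _ => ?_
          rw [if_pos (Finset.mem_insert_self e y), if_neg hex]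
        rw [h1, h2, add_zero, wtW_insert_of_notMem p he hex]
        by_cases hUpx : Up x
        · simp only [if_pos hUpx]
          by_cases hd0z : d0 = 0
          · have hd1z : d1 = 0 := le_antisymm (hd0z ▸ hd10) hd1n
            have hdz : d = 0 := by rw [hd_eq, hd0z, hd1z]; ring
            rw [hβ, hdz, hd0z]; simp
          · rw [hβ]; field_simp
        · simp only [if_neg hUpx]; ring

/-! ### Corollary: Harris–Kleitman by coupling -/

/-- **Nothing flows out of an up-set** — the coupling proof of Harris' inequality in the general form
`μ(Up)·μ(Dn ∧ W) ≤ μ(Dn)·μ(Up ∧ W)` for up-closed `W` (`Dn` down-closed, `Up` up-closed). [this work] -/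
theorem pmass_mul_pmass_le (D : Finset ι) {p : ι → ℝ} (hp0 : ∀ i, 0 ≤ p i) (hp1 : ∀ i, p i ≤ 1)
    (Dn Up W : Finset ι → Prop) (hDn : ∀ ⦃x y : Finset ι⦄, y ⊆ x → Dn x → Dn y)
    (hUp : ∀ ⦃x y : Finset ι⦄, y ⊆ x → Up y → Up x) (hW : ∀ ⦃x y : Finset ι⦄, y ⊆ x → W y → W x) :
    pmass D p Up * pmass D p (fun S => Dn S ∧ W S) ≤ pmass D p Dn * pmass D p (fun S => Up S ∧ W S) := by
  obtain ⟨f, hf⟩ := exists_monotone_transport D hp0 hp1 Dn Up hDn hUp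
  -- LHS = Σ_{y : W y} row(y), RHS = Σ_{x : W x} col(x)
  have hL : pmass D p Up * pmass D p (fun S => Dn S ∧ W S) =
      ∑ y ∈ D.powerset, if W y then ∑ x ∈ D.powerset, f y x else 0 := by
    rw [pmass_eq_sum D p (fun S => Dn S ∧ W S), Finset.mul_sum]
    refine Finset.sum_congr rfl fun y hy => ?_
    rw [hf.row y hy]
    by_cases hWy : W y
    · by_cases hDy : Dn y
      · rw [if_pos ⟨hDy, hWy⟩, if_pos hWy, if_pos hDy]
      · rw [if_neg (fun h => hDy h.1), if_pos hWy, if_neg hDy]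
    · rw [if_neg (fun h => hWy h.2), if_neg hWy]; ring
  have hR : pmass D p Dn * pmass D p (fun S => Up S ∧ W S) =
      ∑ x ∈ D.powerset, if W x then ∑ y ∈ D.powerset, f y x else 0 := by
    rw [pmass_eq_sum D p (fun S => Up S ∧ W S), Finset.mul_sum]
    refine Finset.sum_congr rfl fun x hx => ?_
    rw [hf.col x hx]
    by_cases hWx : W x
    · by_cases hUx : Up x
      · rw [if_pos ⟨hUx, hWx⟩, if_pos hWx, if_pos hUx]
      · rw [if_neg (fun h => hUx h.1), if_pos hWx, if_neg hUx]
    · rw [if_neg (fun h => hWx h.2), if_neg hWx]; ring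
  rw [hL, hR]
  -- mass starting in `W` ends in `W`
  calc ∑ y ∈ D.powerset, (if W y then ∑ x ∈ D.powerset, f y x else 0)
      = ∑ y ∈ D.powerset, (if W y then ∑ x ∈ D.powerset, (if W x then f y x else 0) else 0) := by
        refine Finset.sum_congr rfl fun y _ => ?_
        by_cases hWy : W y
        · rw [if_pos hWy, if_pos hWy]
          refine Finset.sum_congr rfl fun x _ => ?_
          by_cases hWx : W x
          · rw [if_pos hWx]
          · rw [if_neg hWx]
            by_contra h
            exact hWx (hW (hf.supp y x h).1 hWy)
        · rw [if_neg hWy, if_neg hWy]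
    _ ≤ ∑ y ∈ D.powerset, ∑ x ∈ D.powerset, (if W x then f y x else 0) := by
        refine Finset.sum_le_sum fun y _ => ?_
        by_cases hWy : W y
        · rw [if_pos hWy]
        · rw [if_neg hWy]
          exact Finset.sum_nonneg fun x _ => by
            split_ifs
            · exact hf.nonneg y x
            · exact le_rfl
    _ = ∑ x ∈ D.powerset, (if W x then ∑ y ∈ D.powerset, f y x else 0) := by
        rw [Finset.sum_comm]
        refine Finset.sum_congr rfl fun x _ => ?_
        by_cases hWx : W x
        · simp only [if_pos hWx]
        · simp only [if_neg hWx, Finset.sum_const_zero]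

/-- **Harris' inequality by coupling**: `μ(Up)·μ(W) ≤ μ(Up ∧ W)` for up-closed `Up, W` on the weighted cube
(`Dn = ⊤` in `pmass_mul_pmass_le`; the total mass is `1`). [this work] -/
theorem harris_of_transport (D : Finset ι) {p : ι → ℝ} (hp0 : ∀ i, 0 ≤ p i) (hp1 : ∀ i, p i ≤ 1)
    (Up W : Finset ι → Prop) (hUp : ∀ ⦃x y : Finset ι⦄, y ⊆ x → Up y → Up x)
    (hW : ∀ ⦃x y : Finset ι⦄, y ⊆ x → W y → W x) :
    pmass D p Up * pmass D p W ≤ pmass D p (fun S => Up S ∧ W S) := by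
  have h := pmass_mul_pmass_le D hp0 hp1 (fun _ => True) Up W (fun _ _ _ _ => trivial) hUp hW
  have htop : pmass D p (fun _ : Finset ι => True) = 1 := by
    rw [pmass_eq_sum]; simp only [if_true]; exact sum_wtW D p
  have hW' : pmass D p (fun S => True ∧ W S) = pmass D p W := by
    unfold pmass; simp only [true_and]
  rw [hW', htop, one_mul] at h
  exact h

end Summit.CriticalPhenomena.PercolationContinuityZ3.Theorems.C3Transport
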